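import Literature.MathematicalPhysics.QuantumManyBody.PeriodicMaxFormZeroMomentum
import Literature.MathematicalPhysics.QuantumManyBody.PeriodicSlotDepletion
import Summits.AtomisticToContinuum.BoseEinsteinCondensation.Statement

/-!
# Zero-momentum near-minimisers of the rewarded form from a closed translation-invariant class of ground
# states (crux `RewardChordBound`, stmt-AtomisticToContinuum-12876, stub 4b, helper file)

The abstract assembly of stub `stub_rewardedZeroMomentumIntegrable` (translation-invariant near-minimisers of the
REWARDED periodic `N`-boson form `F_s = ⟨·,H·⟩ + s(N - n̂₀)`), in the vocabulary of the Literature max-form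
package (`PeriodicSlotDepletion.lean`: `depletion`, `maxFormR`, `rewardedEnergy`, `rewardedGroundStateEnergy`,
`rewardedGroundStates`; `PeriodicMaxFormTranslation.lean`: diagonal translations `T_b`;
`PeriodicMaxFormZeroMomentum.lean`: MaxFormApproximation in the zero-momentum sector).

`exists_hasTotalMomentum_rewardedEnergy_le`: let `V ⊆ L²((ℝ/ℤ)^{3N})` be a CLOSED subspace consisting of
rewarded ground states (`maxFormR s v L η ≤ R(s)‖η‖²`), stable under the diagonal translations `T_b` and under
`η ↦ |η|`, and containing some `η₁ ≠ 0`. Then for every `δ > 0` there is a periodic `C¹` Bose trial state `Ψ` of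
ZERO TOTAL MOMENTUM with `rewardedEnergy s Ψ ≤ R(s) + δ`. Proof: `|η₁| ∈ V` has positive mean
`⟪e₀, |η₁|⟫ = ∫|η₁| > 0`; its zero-momentum part `ζ` lies in `V` (`exists_invariant_mem_of_isClosed`: averaging
identity and `Vᗮᗮ = V`), is non-zero (same mean) and translation invariant; normalised it is a unit
translation-invariant rewarded ground state, which `exists_invariant_trialState_maxForm_approx` approximates in
the maximal form (and, by the `L²`-Lipschitz bound of the depletion, in the rewarded form) by core states of
zero total momentum. NO uniqueness / positivity-improving input is used: only that the ground-state class is a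
closed subspace stable under translations and `|·|` (Beurling–Deny for the depletion,
`TorusSlotShiftDirichlet.lean`). All `[folklore]`; no definitions.
-/

noncomputable section

open MeasureTheory Filter UnitAddTorus Complex
open scoped ENNReal NNReal Topology InnerProductSpace ComplexConjugate

namespace Summit.AtomisticToContinuum.BoseEinsteinCondensation.Cruxes.RewardChordBound.Birth.ZeroMomentumOfGroundState

open Literature.MathematicalPhysics.QuantumManyBody.BoseGas Literature.Analysis.FunctionSpaces

-- The measure on `ℝ/ℤ` is the Haar PROBABILITY measure, as in `PeriodicFormDomain.lean`.
attribute [local instance] Literature.MathematicalPhysics.QuantumManyBody.BoseGas.formDomain_measureSpace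
  Literature.MathematicalPhysics.QuantumManyBody.BoseGas.formDomain_isProbabilityMeasure
  Literature.MathematicalPhysics.QuantumManyBody.BoseGas.formDomain_isProbabilityMeasure_pi

variable {N : ℕ} {L : ℝ} {v : ℝ → ℝ≥0∞}

/-- **The rewarded energy of a trial state close in `L²` to a unit class `ξ`**: if
`periodicEnergy v Φ ≤ maxForm v L ξ + ε` and `‖ιΦ - ξ‖ ≤ ε`, `‖ξ‖ = 1`, then
`rewardedEnergy s Φ ≤ maxFormR s v L ξ + (1 + 2sN) ε` (`L²`-Lipschitz bound of the depletion). [folklore] -/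
theorem rewardedEnergy_le_maxFormR_add (hL : 0 < L) (hv : Measurable v)
    (hW : ∫⁻ X in cellN N L, periodicInteraction v L X ≠ ⊤) {s : ℝ} (hs : 0 ≤ s)
    (ξ : Lp ℂ 2 (volume : Measure (UnitAddTorus (Fin N × Fin 3)))) (hξ : ‖ξ‖ = 1) (Φ : PeriodicTrialState N L)
    {ε : ℝ} (hε : 0 ≤ ε) (hE : periodicEnergy v Φ ≤ maxForm v L ξ + ENNReal.ofReal ε)
    (hdist : ‖formEmbed hL hv hW ⟨graphEmbed hL hv hW ⟨Φ.ψ, Φ.mem_periodicCore⟩, graphEmbed_mem_formDomain hL hv hW _⟩ - ξ‖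
      ≤ ε) :
    rewardedEnergy hL hv hW s Φ ≤ maxFormR s v L ξ + ENNReal.ofReal ((1 + 2 * s * N) * ε) := by
  set x := formEmbed hL hv hW ⟨graphEmbed hL hv hW ⟨Φ.ψ, Φ.mem_periodicCore⟩, graphEmbed_mem_formDomain hL hv hW _⟩
    with hx
  have hx1 : ‖x‖ = 1 := norm_formEmbed_graphEmbed_trialState hL hv hW Φ
  have hdep : depletion N x ≤ depletion N ξ + 2 * N * ε := by
    have h := abs_depletion_sub_depletion_le x ξ
    rw [hx1, hξ] at h
    have h' := (abs_le.1 h).2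
    nlinarith [norm_nonneg (x - ξ), (Nat.cast_nonneg N : (0 : ℝ) ≤ N)]
  have hd0 : 0 ≤ depletion N ξ := depletion_nonneg ξ
  calc rewardedEnergy hL hv hW s Φ = periodicEnergy v Φ + ENNReal.ofReal (s * depletion N x) := rfl
    _ ≤ (maxForm v L ξ + ENNReal.ofReal ε) + ENNReal.ofReal (s * (depletion N ξ + 2 * N * ε)) :=
        add_le_add hE (ENNReal.ofReal_le_ofReal (mul_le_mul_of_nonneg_left hdep hs))
    _ = maxFormR s v L ξ + ENNReal.ofReal ((1 + 2 * s * N) * ε) := by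
        rw [maxFormR_def, mul_add, ENNReal.ofReal_add (mul_nonneg hs hd0) (by positivity),
          show (1 + 2 * s * N) * ε = ε + s * (2 * N * ε) by ring, ENNReal.ofReal_add hε (by positivity)]
        ring

/-- **Zero-momentum near-minimisers of the rewarded form from a closed translation-invariant class of
ground states.** Let `V` be a closed subspace of `L²((ℝ/ℤ)^{3N})` consisting of rewarded ground states
(`V ⊆ rewardedGroundStates`), stable under all diagonal translations `T_b` and under `η ↦ |η|`, containing some
`η₁ ≠ 0`, and let `R(s) < ∞`, `s ≥ 0`. Then for every `δ > 0` there is a periodic `C¹` Bose trial state `Ψ` of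
zero total momentum with `rewardedEnergy s Ψ ≤ R(s) + δ`. [folklore] -/
theorem exists_hasTotalMomentum_rewardedEnergy_le (hL : 0 < L) (hv : Measurable v)
    (hW : ∫⁻ X in cellN N L, periodicInteraction v L X ≠ ⊤) {s : ℝ} (hs : 0 ≤ s)
    (hR : rewardedGroundStateEnergy hL hv hW s ≠ ⊤)
    (V : Submodule ℂ (Lp ℂ 2 (volume : Measure (UnitAddTorus (Fin N × Fin 3)))))
    (hVc : IsClosed (V : Set (Lp ℂ 2 (volume : Measure (UnitAddTorus (Fin N × Fin 3))))))
    (hVsub : (V : Set (Lp ℂ 2 (volume : Measure (UnitAddTorus (Fin N × Fin 3))))) ⊆ rewardedGroundStates hL hv hW s)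
    (hVT : ∀ (b : UnitAddTorus (Fin 3)) (η : Lp ℂ 2 (volume : Measure (UnitAddTorus (Fin N × Fin 3)))),
      η ∈ V → translateLp b η ∈ V)
    (hVabs : ∀ η : Lp ℂ 2 (volume : Measure (UnitAddTorus (Fin N × Fin 3))), η ∈ V → absLp η ∈ V)
    {η₁ : Lp ℂ 2 (volume : Measure (UnitAddTorus (Fin N × Fin 3)))} (hη₁ : η₁ ∈ V) (hη₁0 : η₁ ≠ 0)
    {δ : ℝ≥0∞} (hδ : 0 < δ) :
    ∃ Ψ : PeriodicTrialState N L, HasTotalMomentum 0 Ψ.ψ ∧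
      rewardedEnergy hL hv hW s Ψ ≤ rewardedGroundStateEnergy hL hv hW s + δ := by
  -- the zero-momentum part `ζ` of `|η₁|`
  have h0 := inner_mFourierLp_zero_absLp_ne_zero hη₁0
  obtain ⟨ζ, hζV, hζcoef, hζinv⟩ := exists_invariant_mem_of_isClosed V hVc hVT (hVabs η₁ hη₁)
  have hζ0 : ζ ≠ 0 := by
    intro hz
    have h := hζcoef 0
    rw [hz, inner_zero_right, if_pos (by funext k; simp)] at h
    exact h0 h.symm
  -- normalise
  have hζn : 0 < ‖ζ‖ := norm_pos_iff.2 hζ0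
  set ξ : Lp ℂ 2 (volume : Measure (UnitAddTorus (Fin N × Fin 3))) := ((‖ζ‖⁻¹ : ℝ) : ℂ) • ζ with hξdef
  have hξV : ξ ∈ V := V.smul_mem _ hζV
  have hξ1 : ‖ξ‖ = 1 := by
    rw [hξdef, norm_smul, Complex.norm_real, Real.norm_of_nonneg (inv_nonneg.2 hζn.le), inv_mul_cancel₀ hζn.ne']
  have hξinv : ∀ b : UnitAddTorus (Fin 3), translateLp b ξ = ξ := fun b => by
    rw [hξdef, LinearIsometry.map_smul, hζinv b]
  obtain ⟨hξsymm, hξR⟩ := hVsub hξV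
  rw [hξ1, one_pow, ENNReal.ofReal_one, mul_one] at hξR
  have hfin : maxForm v L ξ ≠ ⊤ := ne_top_of_le_ne_top hR ((le_self_add).trans ((maxFormR_def s v L ξ).symm.le.trans hξR))
  -- the key approximation at accuracy `ε`
  have key : ∀ ε : ℝ, 0 < ε → ∃ Ψ : PeriodicTrialState N L, HasTotalMomentum 0 Ψ.ψ ∧
      rewardedEnergy hL hv hW s Ψ ≤ rewardedGroundStateEnergy hL hv hW s + ENNReal.ofReal ((1 + 2 * s * N) * ε) := by
    intro ε hε
    obtain ⟨Φ, hmom, hE, hdist⟩ := exists_invariant_trialState_maxForm_approx hL hv hW hv hW ξ hξ1 hξsymm hξinv hfin hε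
    refine ⟨Φ, hmom, (rewardedEnergy_le_maxFormR_add hL hv hW hs ξ hξ1 Φ hε.le hE hdist).trans ?_⟩
    exact add_le_add hξR le_rfl
  -- choose `ε`
  by_cases hδtop : δ = ⊤
  · obtain ⟨Ψ, hmom, -⟩ := key 1 one_pos
    exact ⟨Ψ, hmom, by rw [hδtop, add_top]; exact le_top⟩
  · have hδr : 0 < δ.toReal := ENNReal.toReal_pos hδ.ne' hδtop
    have hc : 0 < 1 + 2 * s * N := by positivity
    obtain ⟨Ψ, hmom, hE⟩ := key (δ.toReal / (1 + 2 * s * N)) (div_pos hδr hc)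
    refine ⟨Ψ, hmom, hE.trans (add_le_add le_rfl ?_)⟩
    rw [mul_div_cancel₀ _ hc.ne', ENNReal.ofReal_toReal hδtop]

end Summit.AtomisticToContinuum.BoseEinsteinCondensation.Cruxes.RewardChordBound.Birth.ZeroMomentumOfGroundState

namespace Summit.AtomisticToContinuum.BoseEinsteinCondensation.Cruxes.RewardChordBound.Birth

open Literature.MathematicalPhysics.QuantumManyBody.BoseGas
open Summit.AtomisticToContinuum.BoseEinsteinCondensation.Cruxes.RewardChordBound.Birth.ZeroMomentumOfGroundState

/-- **Registered sub-goal of stub `stub_rewardedZeroMomentumIntegrable` (helper file): zero-momentum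
near-minimisers of the rewarded form from a closed class of rewarded ground states stable under translations
and `|·|` and containing a non-zero element** (no uniqueness input; the `L²` space is written with the explicit
Haar product measure, definitionally the package's `L2T N`). [folklore] -/
theorem stub_rewardedZeroMomentumIntegrable_OfGroundState :
    ∀ (N : ℕ) (L : ℝ) (v : ℝ → ENNReal) (hL : 0 < L) (hv : Measurable v) (hW : (∫⁻ X in Literature.MathematicalPhysics.QuantumManyBody.BoseGas.cellN N L, Literature.MathematicalPhysics.QuantumManyBody.BoseGas.periodicInteraction v L X) ≠ ⊤) (s : ℝ), 0 ≤ s → Literature.MathematicalPhysics.QuantumManyBody.BoseGas.rewardedGroundStateEnergy hL hv hW s ≠ ⊤ → ∀ (V : Submodule ℂ (MeasureTheory.Lp ℂ 2 (MeasureTheory.Measure.pi fun _ : Fin N × Fin 3 => (AddCircle.haarAddCircle : MeasureTheory.Measure UnitAddCircle)))), IsClosed (V : Set (MeasureTheory.Lp ℂ 2 (MeasureTheory.Measure.pi fun _ : Fin N × Fin 3 => (AddCircle.haarAddCircle : MeasureTheory.Measure UnitAddCircle)))) → (V : Set (MeasureTheory.Lp ℂ 2 (MeasureTheory.Measure.pi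 fun _ : Fin N × Fin 3 => (AddCircle.haarAddCircle : MeasureTheory.Measure UnitAddCircle)))) ⊆ Literature.MathematicalPhysics.QuantumManyBody.BoseGas.rewardedGroundStates hL hv hW s → (∀ (b : UnitAddTorus (Fin 3)) (η : MeasureTheory.Lp ℂ 2 (MeasureTheory.Measure.pi fun _ : Fin N × Fin 3 => (AddCircle.haarAddCircle : MeasureTheory.Measure UnitAddCircle))), η ∈ V → Literature.MathematicalPhysics.QuantumManyBody.BoseGas.translateLp b η ∈ V) → (∀ η : MeasureTheory.Lp ℂ 2 (MeasureTheory.Measure.pi fun _ : Fin N × Fin 3 => (AddCircle.haarAddCircle : MeasureTheory.Measure UnitAddCircle)), η ∈ V → Literature.MathematicalPhysics.QuantumManyBody.BoseGas.absLp η ∈ V) → ∀ η₁ : MeasureTheory.Lp ℂ 2 (MeasureTheory.Measure.pi fun _ : Fin N × Fin 3 => (AddCircle.haarAddCircle : MeasureTheory.Measure UnitAddCircle)), η₁ ∈ V → η₁ ≠ 0 → ∀ δ : ENNReal, 0 < δ → ∃ Ψ : Literature.MathematicalPhysics.QuantumManyBody.BoseGas.PeriodicTrialState N L, Literature.MathematicalPhysics.QuantumManyBody.BoseGas.HasTotalMomentum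 0 Ψ.ψ ∧ Literature.MathematicalPhysics.QuantumManyBody.BoseGas.rewardedEnergy hL hv hW s Ψ ≤ Literature.MathematicalPhysics.QuantumManyBody.BoseGas.rewardedGroundStateEnergy hL hv hW s + δ :=
  fun _ _ _ hL hv hW _ hs hR V hVc hVsub hVT hVabs _ hη₁ hη₁0 _ hδ =>
    exists_hasTotalMomentum_rewardedEnergy_le hL hv hW hs hR V hVc hVsub hVT hVabs hη₁ hη₁0 hδ

end Summit.AtomisticToContinuum.BoseEinsteinCondensation.Cruxes.RewardChordBound.Birth

end
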